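import Mathlib.RepresentationTheory.Homological.ContCohomology.LowDegree
import Mathlib.RepresentationTheory.Homological.ContCohomology.Functoriality
import Literature.NumberTheory.GaloisRepresentations.ContinuousShapiroOpenCoinducedRightAction
import Literature.RepresentationTheory.FiniteGroups.StableLatticeReductionAdmissibleInvariant
import Literature.RepresentationTheory.FiniteGroups.StableLatticeReductionInvariantInt
import HarnessLib

/-!
# Naturality of `H⁰(G, X) ≅ X^G` for continuous cohomology, and the two degree-`0` spellings of
# `H⁰(G, Maps(G ⧸ W, M))` as a `ℤ[G ⧸ W]`-module (Serre, *Corps locaux* VII §5; NSW I §6)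

Topic `NumberTheory/GaloisRepresentations` (continuous cochain cohomology); namespace
`Literature.NumberTheory.GaloisRepresentations` (§1 under `ZeroIsoNaturality`, §2–§3 dot notation
under `ContinuousRep`).  THEOREMS ONLY: no definition, no named fact, no `sorry`, no instance, no
notation.

Mathlib identifies the zeroth continuous cohomology group with the invariants,
`ContinuousCohomology.zeroIso X : continuousCohomology 0 X ≅ X^G` (`ContCohomology/LowDegree`), but
records no compatibility of this isomorphism with the functoriality `ContinuousCohomology.map`
(`ContCohomology/Functoriality`).  §1 proves it: **`H⁰(φ, f)` is `f` on invariants**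
(`zeroIso_hom_map_apply`, for any continuous `φ : H →ₜ* G` and `f : res φ X ⟶ Y`; tree currency
`zeroIso_hom_cohomologyMap_apply` for `cohomologyMap f 0`; morphism forms `map_comp_zeroIso_hom`,
`cohomologyMap_comp_zeroIso_hom`, `zeroIso_inv_comp_cohomologyMap` — `zeroIso` is a natural
isomorphism `continuousCohomology 0 ≅ invariantsFunctor`).  The proof reads the class through
`isoHomologyπ₀_inv_naturality`, `cyclesMap_i` and the kernel-fork description of `Z⁰`
(private `cocycles₀Iso_hom_val`): the invariant attached to a class is the value at `1` of its `0`-cochain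
(`zeroIso_hom_apply_coe`), and `cochainsMap φ f` is `σ ↦ f ∘ σ ∘ φ` with `φ 1 = 1`.

§2 applies this to the coinduced representation `Maps(G ⧸ W, M)` of lane «TATE-EPC-TC»
(`ContinuousRep.coindOpen`, tree file `ContinuousShapiroOpenCoinducedRightAction`): the two
`Δ = G ⧸ W`-module structures in degree `0` — `coindOpenHRep … 0` (`c ↦ H⁰(R_c)` on
`continuousCohomology 0`) and `coindOpenInvariantsRep` (`R_c` restricted to the invariants
`Maps(G ⧸ W, M)^G`) — correspond under `zeroIso` (`zeroIso_hom_coindOpenHRep_zero`,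
`zeroIso_inv_coindOpenInvariantsRep`), hence `H⁰(G, Maps(G ⧸ W, M)) = M^W` as `Δ`-modules through
`continuousCohomology 0` as well (`coindOpenInvariantsEquiv_zeroIso_hom_rep`).  §3 draws the
consequence for the lane's binder pair `(ψ, hψ)` (an additive invariant of finite `p`-torsion
`ℤ[Δ]`-modules, `StableLatticeReductionInvariantInt`; instance binders of `ψ` strict-implicit as in
`AdditiveInvariantExactPieces`): **`ψ (coindOpenInvariantsRep) = ψ (coindOpenHRep … 0)`**
(`additive_coindOpenInvariantsRep_eq_coindOpenHRep_zero`, primed variant with the hypotheses on the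
cohomology side) — the degree-`0` bridge ("delta (i)") between the Kummer-sequence pieces of brick
B8-arith (`CoinducedKummerSequencePieces`, degree `0` as `coindOpenInvariantsRep`) and the base
identity of brick (E) (`TateEulerCharacteristicPrimeToPBase`, degree `0` as `coindOpenHRep … 0`).

Lane «TATE-EPC-TC» of cell `bsd-eis` (crux `GoodLatticeBDPValue`, stmt-BirchSwinnertonDyer-19032).
HONEST FRAMING: homological bookkeeping only; no arithmetic statement and no case of BSD is proved
here.

## References
* J.-P. Serre, *Corps locaux* / *Local Fields* (1979), VII §5 (the `G/H`-module structure of the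
  induced module; `H⁰`). [SerreLocalFields1979]
* J. Neukirch, A. Schmidt, K. Wingberg, *Cohomology of Number Fields*, 2nd ed. (2008), I §6
  Prop. (1.6.4) (Shapiro's lemma, functorial form), (1.3.2). [NeukirchSchmidtWingberg2008]
* J.-P. Serre, *Linear Representations of Finite Groups* (1977), §15.2 Thm. 32 (additive invariants
  are invariants of the isomorphism class). [SerreLinearRepresentations1977]
* J. S. Milne, *Arithmetic Duality Theorems*, 2nd ed. (2006), I §5 (proof of Thm. 5.1: the
  `Gal(L/K)`-module `H⁰(G_{L,S}, μ_p)`). [MilneADT2006]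
-/

noncomputable section

open CategoryTheory Limits

universe u v w

namespace Literature.NumberTheory.GaloisRepresentations

/-! ## §1 Naturality of Mathlib's `ContinuousCohomology.zeroIso` -/

namespace ZeroIsoNaturality

open _root_.TopRep _root_.ContRepresentation _root_.ContinuousCohomology

variable {k : Type u} [Ring k] [TopologicalSpace k]
variable {G H : Type v} [Group G] [TopologicalSpace G] [IsTopologicalGroup G]
  [Group H] [TopologicalSpace H] [IsTopologicalGroup H]

/-- The composite `Z⁰(G, X) ≅ ker d⁰ ↪ C⁰(G, X)` of Mathlib's `cocycles₀Iso` with the kernel inclusion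
is the inclusion of cycles `iCycles` (the kernel fork `iCycles` is mapped to the kernel fork `kerι`
along the identity of the arrow `d⁰`); private plumbing helper. [folklore] -/
private theorem cocycles₀Iso_hom_val (X : TopRep.{max v w} k G) (z : cocycles X 0) :
    ((cocycles₀Iso X).hom z : ((homogeneousCochains X).d 0 1).hom.ker).1 =
      (homogeneousCochains X).iCycles 0 z := by
  have h := ConcreteCategory.congr_hom (KernelFork.mapOfIsLimit_ι
    (KernelFork.ofι ((homogeneousCochains X).iCycles 0) ((homogeneousCochains X).iCycles_d 0 1))
    (TopModuleCat.isLimitKer ((homogeneousCochains X).d 0 1))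
    (Iso.refl (Arrow.mk ((homogeneousCochains X).d 0 1))).hom) z
  dsimp at h
  exact h

/-- **The formula for `zeroIso`**: the invariant attached to a degree-`0` class is the value at
`1 ∈ G` of the homogeneous `0`-cochain `σ : C(G, X)` representing it (`H⁰(G, A) = A^G` read on
homogeneous cochains: a `G`-invariant `x : G → A` is constant, `x ↦ x(1)`).
[cite: NeukirchSchmidtWingberg2008, I §2 (definition of `Hⁿ(G, A)` by homogeneous cochains; `H⁰(G, A) = A^G`)] -/
theorem zeroIso_hom_apply_coe (X : TopRep.{max v w} k G) (x : continuousCohomology 0 X) :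
    (((zeroIso X).hom x : X.ρ.invariants) : X) =
      (((homogeneousCochains X).iCycles 0 ((homogeneousCochains X).isoHomologyπ₀.inv x) :
        (homogeneousCochains X).X 0).1 : C(G, X)) 1 := by
  change ((d₀kerIso X ((cocycles₀Iso X).hom ((homogeneousCochains X).isoHomologyπ₀.inv x)) :
    X.ρ.invariants) : X) = _
  rw [← cocycles₀Iso_hom_val]
  rfl

/-- **Naturality of `zeroIso`: `H⁰(φ, f)` is `f` on invariants.**  For a continuous group
homomorphism `φ : H →ₜ* G`, a morphism `f : res φ X ⟶ Y` of topological `H`-representations and a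
class `x ∈ H⁰(G, X)`, the invariant of `ContinuousCohomology.map φ f 0 x ∈ H⁰(H, Y)` is `f` applied to
the invariant of `x` (the square `H⁰(G, X) → H⁰(H, Y)` over `X^G → Y^H` commutes).
[cite: NeukirchSchmidtWingberg2008, I §5–§6 (functoriality of `H⁰ = (–)^G`)] -/
theorem zeroIso_hom_map_apply {X : TopRep.{max v w} k G} {Y : TopRep.{max v w} k H} (φ : H →ₜ* G)
    (f : res (φ : H →* G) X ⟶ Y) (x : continuousCohomology 0 X) :
    (((zeroIso Y).hom (ContinuousCohomology.map φ f 0 x) : Y.ρ.invariants) : Y) =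
      f.hom (((zeroIso X).hom x : X.ρ.invariants) : X) := by
  rw [zeroIso_hom_apply_coe, zeroIso_hom_apply_coe]
  have hnat := congrArg (fun ψ => (ψ : continuousCohomology 0 X ⟶ _) x)
    (CochainComplex.isoHomologyπ₀_inv_naturality (cochainsMap φ f))
  simp only [TopModuleCat.hom_comp, ContinuousLinearMap.coe_comp, Function.comp_apply] at hnat
  change (((homogeneousCochains Y).iCycles 0
      ((homogeneousCochains Y).isoHomologyπ₀.inv (HomologicalComplex.homologyMap (cochainsMap φ f) 0 x)) :
        (homogeneousCochains Y).X 0).1 : C(H, Y)) 1 = _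
  rw [hnat]
  have hi := congrArg (fun ψ => (ψ : cocycles X 0 ⟶ _) ((homogeneousCochains X).isoHomologyπ₀.inv x))
    (HomologicalComplex.cyclesMap_i (cochainsMap φ f) 0)
  simp only [TopModuleCat.hom_comp, ContinuousLinearMap.coe_comp, Function.comp_apply] at hi
  rw [hi, cochainsMap_f]
  change f.hom ((((homogeneousCochains X).iCycles 0 ((homogeneousCochains X).isoHomologyπ₀.inv x) :
        (homogeneousCochains X).X 0).1 : C(G, X)) (φ 1)) = _
  rw [map_one]

/-- **Tree currency**: for a morphism `f : A ⟶ B` of topological representations of `G`, the map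
`H⁰(f) = cohomologyMap f 0` of the tree (`ContinuousCohomologyConnecting`) is `f` on invariants under
`zeroIso`. [cite: NeukirchSchmidtWingberg2008, I §5–§6 (functoriality of `H⁰ = (–)^G`)] -/
theorem zeroIso_hom_cohomologyMap_apply {A B : TopRep.{v} k G} (f : A ⟶ B)
    (x : continuousCohomology 0 A) :
    (((zeroIso B).hom ((cohomologyMap f 0).hom x) : B.ρ.invariants) : B) =
      f.hom (((zeroIso A).hom x : A.ρ.invariants) : A) :=
  zeroIso_hom_map_apply (ContinuousMonoidHom.id G) (resIdHom f) x

/-- **Naturality square for `zeroIso` (morphism form)**: `H⁰(φ, f) ≫ zeroIso_Y = zeroIso_X ≫ (f on invariants)`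
in `TopModuleCat k`, the second arrow being Mathlib's `TopRep.invariantsResMap φ f`.
[cite: NeukirchSchmidtWingberg2008, I §5–§6 (functoriality of `H⁰ = (–)^G`)] -/
theorem map_comp_zeroIso_hom {X : TopRep.{max v w} k G} {Y : TopRep.{max v w} k H} (φ : H →ₜ* G)
    (f : res (φ : H →* G) X ⟶ Y) :
    ContinuousCohomology.map φ f 0 ≫ (zeroIso Y).hom =
      (zeroIso X).hom ≫ invariantsResMap (φ : H →* G) f := by
  apply ConcreteCategory.hom_ext
  intro x
  apply Subtype.ext
  exact zeroIso_hom_map_apply φ f x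

/-- **Naturality square for `zeroIso` along a morphism of `G`-representations**:
`H⁰(f) ≫ zeroIso_B = zeroIso_A ≫ f^G` with `H⁰(f) = cohomologyMap f 0` (tree) and
`f^G = (invariantsFunctor k G).map f` (Mathlib), i.e. `zeroIso` is a natural isomorphism
`continuousCohomology 0 ≅ invariantsFunctor` on the tree's `cohomologyMap`.
[cite: NeukirchSchmidtWingberg2008, I §5–§6 (functoriality of `H⁰ = (–)^G`)] -/
theorem cohomologyMap_comp_zeroIso_hom {A B : TopRep.{v} k G} (f : A ⟶ B) :
    cohomologyMap f 0 ≫ (zeroIso B).hom = (zeroIso A).hom ≫ (invariantsFunctor k G).map f := by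
  apply ConcreteCategory.hom_ext
  intro x
  apply Subtype.ext
  exact zeroIso_hom_cohomologyMap_apply f x

/-- The inverse square: `zeroIso_A.inv ≫ H⁰(f) = f^G ≫ zeroIso_B.inv`.
[cite: NeukirchSchmidtWingberg2008, I §5–§6 (functoriality of `H⁰ = (–)^G`)] -/
theorem zeroIso_inv_comp_cohomologyMap {A B : TopRep.{v} k G} (f : A ⟶ B) :
    (zeroIso A).inv ≫ cohomologyMap f 0 = (invariantsFunctor k G).map f ≫ (zeroIso B).inv := by
  rw [Iso.inv_comp_eq, ← Category.assoc, Iso.eq_comp_inv]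
  exact cohomologyMap_comp_zeroIso_hom f

/-- Element form of the inverse square: `H⁰(f) (zeroIso_A.inv a) = zeroIso_B.inv (f^G a)`.
[cite: NeukirchSchmidtWingberg2008, I §5–§6 (functoriality of `H⁰ = (–)^G`)] -/
theorem cohomologyMap_zeroIso_inv_apply {A B : TopRep.{v} k G} (f : A ⟶ B) (a : A.ρ.invariants) :
    (cohomologyMap f 0).hom ((zeroIso A).inv a) =
      (zeroIso B).inv ((invariantsFunctor k G).map f a) := by
  have h := ConcreteCategory.congr_hom (zeroIso_inv_comp_cohomologyMap f) a
  dsimp at h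
  exact h

end ZeroIsoNaturality

/-! ## §2 `H⁰(G, Maps(G ⧸ W, M))` versus `Maps(G ⧸ W, M)^G` as `Δ`-modules -/

namespace ContinuousRep

open _root_.TopRep _root_.ContRepresentation _root_.ContinuousCohomology

variable {G : Type u} [Group G] [TopologicalSpace G] [IsTopologicalGroup G] [CompactSpace G]
variable {M : Type u} [AddCommGroup M] [TopologicalSpace M] [DiscreteTopology M]
variable (ρ : ContinuousRep G ℤ M) (W : Subgroup G) [W.Normal] (hW : IsOpen (W : Set G))

/-- **`zeroIso` intertwines the two degree-`0` actions of `Δ = G ⧸ W`**: it carries `H⁰(R_c)`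
(`coindOpenHRep … 0 c` on `continuousCohomology 0 (Maps(G ⧸ W, M))`) to the restriction of the right
translation `R_c` to the invariants (`coindOpenInvariantsRep c` on `Maps(G ⧸ W, M)^G`).
[cite: SerreLocalFields1979, VII §5] [cite: NeukirchSchmidtWingberg2008, I §6 Prop. (1.6.4)] -/
theorem zeroIso_hom_coindOpenHRep_zero (c : G ⧸ W)
    (x : continuousCohomology 0 (ρ.coindOpen W hW).toTopRep) :
    (zeroIso (ρ.coindOpen W hW).toTopRep).hom (ρ.coindOpenHRep W hW 0 c x) =
      ρ.coindOpenInvariantsRep W hW c ((zeroIso (ρ.coindOpen W hW).toTopRep).hom x) := by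
  apply Subtype.ext
  rw [coindOpenHRep_apply, ZeroIsoNaturality.zeroIso_hom_cohomologyMap_apply]
  rfl

/-- The inverse direction: `zeroIso.inv` carries `coindOpenInvariantsRep c` to `H⁰(R_c)`.
[cite: SerreLocalFields1979, VII §5] [cite: NeukirchSchmidtWingberg2008, I §6 Prop. (1.6.4)] -/
theorem zeroIso_inv_coindOpenInvariantsRep (c : G ⧸ W) (φ : (ρ.coindOpen W hW).toTopRep.ρ.invariants) :
    (zeroIso (ρ.coindOpen W hW).toTopRep).inv (ρ.coindOpenInvariantsRep W hW c φ) =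
      ρ.coindOpenHRep W hW 0 c ((zeroIso (ρ.coindOpen W hW).toTopRep).inv φ) := by
  apply (zeroIso (ρ.coindOpen W hW).toTopRep).toContinuousLinearEquiv.injective
  change (zeroIso (ρ.coindOpen W hW).toTopRep).hom
      ((zeroIso (ρ.coindOpen W hW).toTopRep).inv (ρ.coindOpenInvariantsRep W hW c φ)) =
    (zeroIso (ρ.coindOpen W hW).toTopRep).hom
      (ρ.coindOpenHRep W hW 0 c ((zeroIso (ρ.coindOpen W hW).toTopRep).inv φ))
  rw [zeroIso_hom_coindOpenHRep_zero, Iso.inv_hom_id_apply, Iso.inv_hom_id_apply]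

/-- **`H⁰(G, Maps(G ⧸ W, M)) = M^W` as `Δ`-modules, through `continuousCohomology 0`**: the composite
of `zeroIso` with `coindOpenInvariantsEquiv` (`φ ↦ φ(1)`) carries `H⁰(R_c)` to the natural action of
`c ∈ G ⧸ W` on `M^W` (`ContinuousRep.quotientInvariants`).
[cite: SerreLocalFields1979, VII §5] [cite: NeukirchSchmidtWingberg2008, I §6 Prop. (1.6.4)] -/
theorem coindOpenInvariantsEquiv_zeroIso_hom_rep (c : G ⧸ W)
    (x : continuousCohomology 0 (ρ.coindOpen W hW).toTopRep) :
    ρ.coindOpenInvariantsEquiv W hW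
        ((zeroIso (ρ.coindOpen W hW).toTopRep).hom (ρ.coindOpenHRep W hW 0 c x)) =
      ρ.quotientInvariants W c
        (ρ.coindOpenInvariantsEquiv W hW ((zeroIso (ρ.coindOpen W hW).toTopRep).hom x)) := by
  rw [zeroIso_hom_coindOpenHRep_zero, coindOpenInvariantsEquiv_rep]

omit [W.Normal] in
/-- Finiteness of `H⁰(G, Maps(G ⧸ W, M))` is finiteness of the invariants `Maps(G ⧸ W, M)^G`
(transport along `zeroIso`). [cite: SerreLocalFields1979, VII §5] -/
theorem finite_continuousCohomology_zero_coindOpen_iff :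
    Finite (continuousCohomology 0 (ρ.coindOpen W hW).toTopRep) ↔
      Finite (ρ.coindOpen W hW).toTopRep.ρ.invariants :=
  ⟨fun _ => Finite.of_equiv _ (zeroIso (ρ.coindOpen W hW).toTopRep).toContinuousLinearEquiv.toEquiv,
    fun _ => Finite.of_equiv _
      (zeroIso (ρ.coindOpen W hW).toTopRep).toContinuousLinearEquiv.symm.toEquiv⟩

omit [W.Normal] in
/-- `p`-torsion of `H⁰(G, Maps(G ⧸ W, M))` is `p`-torsion of the invariants (transport along
`zeroIso`, in the additive group's `ℤ`-action as in the lane's `hψ`). [cite: SerreLocalFields1979, VII §5] -/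
theorem forall_zsmul_continuousCohomology_zero_coindOpen_eq_zero_iff (n : ℤ) :
    (∀ x : continuousCohomology 0 (ρ.coindOpen W hW).toTopRep, n • x = 0) ↔
      ∀ φ : (ρ.coindOpen W hW).toTopRep.ρ.invariants, n • φ = 0 := by
  constructor
  · intro h φ
    have h1 := congrArg (zeroIso (ρ.coindOpen W hW).toTopRep).toContinuousLinearEquiv
      (h ((zeroIso (ρ.coindOpen W hW).toTopRep).toContinuousLinearEquiv.symm φ))
    rwa [map_zsmul, map_zero, ContinuousLinearEquiv.apply_symm_apply] at h1
  · intro h x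
    have h1 := congrArg (zeroIso (ρ.coindOpen W hW).toTopRep).toContinuousLinearEquiv.symm
      (h ((zeroIso (ρ.coindOpen W hW).toTopRep).toContinuousLinearEquiv x))
    rwa [map_zsmul, map_zero, ContinuousLinearEquiv.symm_apply_apply] at h1

/-! ## §3 The degree-`0` class for an additive invariant `ψ` (lane binder pair `(ψ, hψ)`) -/

section Additive

open Literature.RepresentationTheory.FiniteGroups

variable {A : Type*} [AddCommGroup A] {p : ℕ}
variable (ψ : ∀ ⦃X : Type u⦄ ⦃_ : AddCommGroup X⦄ ⦃_ : Module ℤ X⦄, Representation ℤ (G ⧸ W) X → A)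
  (hψ : ∀ ⦃X Y Z : Type u⦄ [AddCommGroup X] [Module ℤ X] [AddCommGroup Y] [Module ℤ Y]
    [AddCommGroup Z] [Module ℤ Z] (ρX : Representation ℤ (G ⧸ W) X)
    (ρY : Representation ℤ (G ⧸ W) Y) (ρZ : Representation ℤ (G ⧸ W) Z) (f : X →ₗ[ℤ] Y)
    (g : Y →ₗ[ℤ] Z), (∀ s x, f (ρX s x) = ρY s (f x)) → (∀ s y, g (ρY s y) = ρZ s (g y)) →
    Function.Injective f → Function.Surjective g → LinearMap.range f = LinearMap.ker g →
    Finite Y → (∀ y : Y, (p : ℤ) • y = 0) → ψ ρY = ψ ρX + ψ ρZ)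
include hψ

/-- **`ψ (Maps(G ⧸ W, M)^G) = ψ (H⁰(G, Maps(G ⧸ W, M)))`** for every additive invariant `ψ` of finite
`p`-torsion `ℤ[G ⧸ W]`-modules (the lane's binder pair `(ψ, hψ)`; `ψ` with strict-implicit instance
binders, so that it applies to the `TopModuleCat` carrier of the cohomology with its own `Module ℤ`),
provided the invariants are finite and killed by `p`: the two degree-`0` spellings
`coindOpenInvariantsRep` and `coindOpenHRep … 0` have the same class, `zeroIso` being a
`Δ`-isomorphism between them. [cite: SerreLinearRepresentations1977, §15.2 Thm. 32]
[cite: SerreLocalFields1979, VII §5] -/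
theorem additive_coindOpenInvariantsRep_eq_coindOpenHRep_zero
    [Finite (ρ.coindOpen W hW).toTopRep.ρ.invariants]
    (htor : ∀ φ : (ρ.coindOpen W hW).toTopRep.ρ.invariants, (p : ℤ) • φ = 0) :
    ψ (ρ.coindOpenInvariantsRep W hW) = ψ (ρ.coindOpenHRep W hW 0) := by
  obtain ⟨-, good_quot, hψ'⟩ := StableLatticeReduction.Int.admissible ψ hψ
  exact (StableLatticeReduction.Admissible.additive_eq_of_linearEquiv ψ _ good_quot hψ'
    (ρ.coindOpenHRep W hW 0) (ρ.coindOpenInvariantsRep W hW) ⟨‹_›, htor⟩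
    (zeroIso (ρ.coindOpen W hW).toTopRep).toContinuousLinearEquiv.toLinearEquiv
    (fun c x => ρ.zeroIso_hom_coindOpenHRep_zero W hW c x)).symm

/-- The same identity **`ψ (Maps(G ⧸ W, M)^G) = ψ (H⁰(G, Maps(G ⧸ W, M)))`** with the finiteness and
`p`-torsion hypotheses placed on the cohomology group `continuousCohomology 0 (Maps(G ⧸ W, M))`.
[cite: SerreLinearRepresentations1977, §15.2 Thm. 32] [cite: SerreLocalFields1979, VII §5] -/
theorem additive_coindOpenInvariantsRep_eq_coindOpenHRep_zero'
    [Finite (continuousCohomology 0 (ρ.coindOpen W hW).toTopRep)]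
    (htor : ∀ x : continuousCohomology 0 (ρ.coindOpen W hW).toTopRep, (p : ℤ) • x = 0) :
    ψ (ρ.coindOpenInvariantsRep W hW) = ψ (ρ.coindOpenHRep W hW 0) := by
  haveI : Finite (ρ.coindOpen W hW).toTopRep.ρ.invariants :=
    (ρ.finite_continuousCohomology_zero_coindOpen_iff W hW).1 ‹_›
  exact ρ.additive_coindOpenInvariantsRep_eq_coindOpenHRep_zero W hW ψ hψ
    ((ρ.forall_zsmul_continuousCohomology_zero_coindOpen_eq_zero_iff W hW (p : ℤ)).1 htor)

/-- **Hypothesis-free form for finite `p`-torsion coefficients**: if `M` is finite and killed by `p`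
(e.g. `M = B[p]`, `μ_p`), then `ψ (Maps(G ⧸ W, M)^G) = ψ (H⁰(G, Maps(G ⧸ W, M)))` for the lane's `(ψ, hψ)`
outright — `G ⧸ W` is finite (`W` open, `G` compact), so the invariant functions `G ⧸ W → M` form a
finite group killed by `p`. [cite: SerreLinearRepresentations1977, §15.2 Thm. 32]
[cite: SerreLocalFields1979, VII §5] -/
theorem additive_coindOpenInvariantsRep_eq_coindOpenHRep_zero_of_finite [Finite M]
    (hM : ∀ m : M, (p : ℤ) • m = 0) :
    ψ (ρ.coindOpenInvariantsRep W hW) = ψ (ρ.coindOpenHRep W hW 0) := by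
  haveI : Finite (G ⧸ W) := Subgroup.quotient_finite_of_isOpen W hW
  haveI : Finite (ρ.coindOpen W hW).toTopRep.ρ.invariants :=
    Finite.of_injective (fun φ : (ρ.coindOpen W hW).toTopRep.ρ.invariants => (φ : G ⧸ W → M))
      Subtype.val_injective
  refine ρ.additive_coindOpenInvariantsRep_eq_coindOpenHRep_zero W hW ψ hψ fun φ => Subtype.ext ?_
  rw [Submodule.coe_smul, Submodule.coe_zero]
  funext y
  exact hM _

end Additive

end ContinuousRep

end Literature.NumberTheory.GaloisRepresentations

end
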